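import Summits.Ventures.Crystal3D.Theorems.StickyWulffConstantGenericWallFloorDoubleTopFar
import Summits.Ventures.Crystal3D.Theorems.StickyWulffConstantGenericWallFloorDoubleStarCoaxial
import Summits.Ventures.Crystal3D.Theorems.StickyWulffConstantGenericWallFloorStarTransport
import HarnessLib

/-!
# `DoubleStarCoaxialAt A₁ A₂` from `DoubleTopFar`: the tilted double tops, modulo the interval certificate
# (crux `GenericWallFloor`, line `WallLedgerG`; discharges `#DT₁₁` of the sealed chain ledger)

HONEST FRAMING. Part of the venture `Summits/Ventures/Crystal3D` (cell `crystal3d-full`), helper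
`--supports` the crux `GenericWallFloor` (stmt-Ventures-19480) of `route-Ventures-StickyWulffConstant`,
registered line `WallLedgerG`, open stub `stub_twoSlabAdhesion`.  19480-p2's
`twoSlabAdhesion_sealed_of_doubleStarCoaxial` (…DoubleStarCoaxial) is the chain ledger with the crux's
non-co-axiality hypothesis verbatim and the inputs `ExactOnly`(C12-55) and `DoubleStarCoaxialAt A₁ A₂`
(cf-p1 ROUTE §82(3)/(7), «DoubleTopDegree»).

**`doubleStarCoaxialAt_of_far : DoubleTopFar → ∀ A₁ A₂, DoubleStarCoaxialAt A₁ A₂`.**  So the tilted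
double tops reduce to the ONE named computational hypothesis `DoubleTopFar` (…DoubleTopFar: the global,
positive-margin half of R39d — interval branch and bound over `SO(3)`), the local half being the `46`
kernel-checked certificate balls of …DoubleTopLocalAtlasA/B.

Proof: slot transitivity (`exists_latticeIso_map_slot`) normalises `u₁ = u₂ = slotSite 0`; the affine
isometry `x ↦ e + A₁g₁x` carries the walk cluster `wPt` onto the predecessor dozen of grain 1 and `R·wPt`,
`R = (A₁g₁)⁻¹A₂g₂`, onto that of grain 2; the eleventh neighbour `y` of `e` is off all `26` cluster balls
(off the ten star balls by hypothesis, off the others by `dist e y = 1`), so `coaxial_of_doubleTop` makes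
`(Λ₀, R·Λ₀)` co-axial, i.e. `(A₁·Λ₀, A₂·Λ₀)` co-axial (`coaxial_of_common_frame`).

WHAT THIS IS NOT: `DoubleTopFar` (R39d) is NOT proved; rung F-C1 not moved.
-/

noncomputable section

namespace Summit.Ventures.Crystal3D.Theorems

open Matrix NearIdentity Finset
open Literature.MathematicalPhysics.StatisticalMechanics (fccStacking barlowStacking IsHaggSeq)
open scoped InnerProductSpace

/-- Table check: every non-centre ball of the walk cluster lies strictly below the equator of the walk
slot (`F̂ i ⬝ (1,1,0) < 0`). -/
theorem clusterInt_slot_facts : ∀ i : Fin 13, clusterQ i ≠ 0 → dotQ (clusterQ i) (slotQ 0) < 0 := by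
  decide +kernel

/-- `2‖wPt i‖² = |F̂ i|²`. -/
theorem two_mul_norm_sq_wPt (i : Fin 13) : 2 * ‖wPt i‖ ^ 2 = ((dotQ (clusterQ i) (clusterQ i) : ℚ) : ℝ) := by
  rw [← sqrt_two_smul_cubicCoords_dot_self, sqrt_two_smul_cubicCoords_wPt, cast_dotQ]; rfl

/-- `2⟪wPt i, slotSite 0⟫ = F̂ i ⬝ (1,1,0)`. -/
theorem two_mul_inner_wPt_slot (i : Fin 13) :
    2 * ⟪wPt i, slotSite 0⟫_ℝ = ((dotQ (clusterQ i) (slotQ 0) : ℚ) : ℝ) := by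
  have hs : Real.sqrt 2 ^ 2 = 2 := Real.sq_sqrt (by norm_num)
  rw [inner_eq_cubicCoords, cast_dotQ]
  have h1 : castVec (clusterQ i) = Real.sqrt 2 • cubicCoords (wPt i) := (sqrt_two_smul_cubicCoords_wPt i).symm
  have h2 : castVec (slotQ 0) = Real.sqrt 2 • cubicCoords (slotSite 0) := by
    rw [cubicCoords_slotSite]; ext l; simp [castVec, slotQ, slotVec]; field_simp
  rw [h1, h2, smul_dotProduct, dotProduct_smul, smul_eq_mul, smul_eq_mul, ← mul_assoc, ← pow_two, hs]

/-- The walk cluster lies in `Λ₀`. -/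
theorem wPt_mem_fcc (i : Fin 13) : wPt i ∈ fccStacking 1 (Real.sqrt (2 / 3)) := by
  refine Fin.cases ?_ (fun k => ?_) i
  · exact fcc_neg_mem (mem_fcc_of_mem_fccSlots (slotSite_mem 0))
  · exact add_mem_fcc_of_mem_fccSlots (fcc_neg_mem (mem_fcc_of_mem_fccSlots (slotSite_mem 0))) (slotSite_mem k)

/-- **`DoubleStarCoaxialAt` from `DoubleTopFar`.**  See the module docstring. -/
theorem doubleStarCoaxialAt_of_far (hfar : DoubleTopFar)
    (A₁ A₂ : EuclideanSpace ℝ (Fin 3) ≃ₗᵢ[ℝ] EuclideanSpace ℝ (Fin 3)) : DoubleStarCoaxialAt A₁ A₂ := by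
  classical
  intro u₁ hu₁ u₂ hu₂ X hX e _he hd₁ hfull₁ hd₂ hfull₂ y' hy'X hy'd hoff₁ hoff₂
  -- slot normalisation
  obtain ⟨g₁, hg₁, hg₁', hg₁s⟩ := exists_latticeIso_map_slot (slotSite_mem 0) hu₁
  obtain ⟨g₂, hg₂, hg₂', hg₂s⟩ := exists_latticeIso_map_slot (slotSite_mem 0) hu₂
  set B₁ := g₁.trans A₁ with hB₁
  set B₂ := g₂.trans A₂ with hB₂
  set R := B₂.trans B₁.symm with hR
  have hRapp : ∀ x, B₁ (R x) = B₂ x := fun x => by simp [hR]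
  -- the two dozens
  set P : Fin 13 → EuclideanSpace ℝ (Fin 3) := fun i => e + B₁ (wPt i) with hP
  set Q : Fin 13 → EuclideanSpace ℝ (Fin 3) := fun j => e + B₂ (wPt j) with hQ
  have hwPt : ∀ (g : EuclideanSpace ℝ (Fin 3) ≃ₗᵢ[ℝ] EuclideanSpace ℝ (Fin 3))
      (A : EuclideanSpace ℝ (Fin 3) ≃ₗᵢ[ℝ] EuclideanSpace ℝ (Fin 3)) (u : EuclideanSpace ℝ (Fin 3)),
      (∀ p ∈ fccStacking 1 (Real.sqrt (2 / 3)), g p ∈ fccStacking 1 (Real.sqrt (2 / 3))) → g (slotSite 0) = u →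
      e - A u ∈ X → (∀ w ∈ fccSlots, e - A u + A w ∈ X) → ∀ i, e + A (g (wPt i)) ∈ X := by
    intro g A u hg hgs hd hfull i
    refine Fin.cases ?_ (fun k => ?_) i
    · show e + A (g (-slotSite 0)) ∈ X
      rw [map_neg, hgs, map_neg, ← sub_eq_add_neg]; exact hd
    · show e + A (g (-slotSite 0 + slotSite k)) ∈ X
      rw [map_add, map_neg, hgs, map_add, map_neg, ← add_assoc, ← sub_eq_add_neg]
      exact hfull _ (map_mem_fccSlots g hg (slotSite_mem k))
  have hPX : ∀ i, P i ∈ X := hwPt g₁ A₁ u₁ hg₁ hg₁s hd₁ hfull₁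
  have hQX : ∀ j, Q j ∈ X := hwPt g₂ A₂ u₂ hg₂ hg₂s hd₂ hfull₂
  have hQP : ∀ j, Q j = e + B₁ (R (wPt j)) := fun j => by rw [hRapp]
  have hdist : ∀ a b : EuclideanSpace ℝ (Fin 3), dist (e + B₁ a) (e + B₁ b) = dist a b := by
    intro a b; rw [dist_eq_norm, dist_eq_norm, add_sub_add_left_eq_sub, ← map_sub, LinearIsometryEquiv.norm_map]
  have hclus : ∀ i j : Fin 13, wPt i = R (wPt j) ∨ 1 ≤ dist (wPt i) (R (wPt j)) := by
    intro i j
    by_cases h : P i = Q j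
    · left
      rw [hQP j] at h
      exact B₁.injective (add_left_cancel h)
    · right
      have := hX _ (hPX i) _ (hQX j) h
      rwa [hQP j, hdist] at this
  -- the eleventh neighbour is off all cluster balls
  have hstar : ∀ (g : EuclideanSpace ℝ (Fin 3) ≃ₗᵢ[ℝ] EuclideanSpace ℝ (Fin 3))
      (A : EuclideanSpace ℝ (Fin 3) ≃ₗᵢ[ℝ] EuclideanSpace ℝ (Fin 3)) (u : EuclideanSpace ℝ (Fin 3)),
      (∀ p ∈ fccStacking 1 (Real.sqrt (2 / 3)), g p ∈ fccStacking 1 (Real.sqrt (2 / 3))) → g (slotSite 0) = u →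
      (∀ w ∈ fccSlots, ⟪w, u⟫_ℝ < 0 → y' ≠ e + A w) → ∀ i, y' ≠ e + A (g (wPt i)) := by
    intro g A u hg hgs hoff i hyi
    -- `dist e y' = 1` forces `‖wPt i‖ = 1`, hence `g (wPt i)` is a slot below the equator of `u`
    have hn : ‖wPt i‖ = 1 := by
      have := hy'd
      rw [hyi, dist_eq_norm, show e - (e + A (g (wPt i))) = -(A (g (wPt i))) by abel, norm_neg,
        LinearIsometryEquiv.norm_map, LinearIsometryEquiv.norm_map] at this
      exact this
    have hne : clusterQ i ≠ 0 := by
      intro h0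
      have h2 := two_mul_norm_sq_wPt i
      rw [hn, h0] at h2
      norm_num [dotQ] at h2
    have hslot : g (wPt i) ∈ fccSlots :=
      mem_fccSlots_of_unit (hg _ (wPt_mem_fcc i)) (by rw [LinearIsometryEquiv.norm_map, hn])
    have hneg : ⟪g (wPt i), u⟫_ℝ < 0 := by
      rw [← hgs, LinearIsometryEquiv.inner_map_map]
      have h := two_mul_inner_wPt_slot i
      have hlt : ((dotQ (clusterQ i) (slotQ 0) : ℚ) : ℝ) < 0 := by exact_mod_cast clusterInt_slot_facts i hne
      linarith
    exact hoff _ hslot hneg hyi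
  have hy'P : ∀ i, y' ≠ P i := hstar g₁ A₁ u₁ hg₁ hg₁s hoff₁
  have hy'Q : ∀ j, y' ≠ Q j := hstar g₂ A₂ u₂ hg₂ hg₂s hoff₂
  set y := B₁.symm (y' - e) with hy
  have hy'e : y' = e + B₁ y := by rw [hy, LinearIsometryEquiv.apply_symm_apply]; abel
  have hyn : ‖y‖ = 1 := by
    rw [hy, LinearIsometryEquiv.norm_map, ← dist_eq_norm, dist_comm]; exact hy'd
  have hyF : ∀ i, clusterQ i ≠ 0 → 1 ≤ dist y (wPt i) := by
    intro i _
    have := hX _ hy'X _ (hPX i) (hy'P i)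
    rwa [hy'e, hP, hdist] at this
  have hyM : ∀ j, clusterQ j ≠ 0 → 1 ≤ dist y (R (wPt j)) := by
    intro j _
    have := hX _ hy'X _ (hQX j) (hy'Q j)
    rwa [hy'e, hQP j, hdist] at this
  obtain ⟨L, hL1, hL2⟩ := coaxial_of_doubleTop hfar R y hclus hyn hyF hyM
  -- transport the common frame by `B₁ = A₁ ∘ g₁`
  have himg : ∀ (g : EuclideanSpace ℝ (Fin 3) ≃ₗᵢ[ℝ] EuclideanSpace ℝ (Fin 3))
      (A : EuclideanSpace ℝ (Fin 3) ≃ₗᵢ[ℝ] EuclideanSpace ℝ (Fin 3)),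
      (∀ p ∈ fccStacking 1 (Real.sqrt (2 / 3)), g p ∈ fccStacking 1 (Real.sqrt (2 / 3))) →
      (∀ p ∈ fccStacking 1 (Real.sqrt (2 / 3)), g.symm p ∈ fccStacking 1 (Real.sqrt (2 / 3))) →
      A '' fccStacking 1 (Real.sqrt (2 / 3)) = (g.trans A) '' fccStacking 1 (Real.sqrt (2 / 3)) := by
    intro g A hg hg'
    rw [LinearIsometryEquiv.coe_trans, Set.image_comp]
    congr 1
    apply Set.Subset.antisymm
    · intro p hp; exact ⟨g.symm p, hg' p hp, g.apply_symm_apply p⟩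
    · rintro _ ⟨p, hp, rfl⟩; exact hg p hp
  have hΛ₁ : A₁ '' fccStacking 1 (Real.sqrt (2 / 3)) = B₁ '' fccStacking 1 (Real.sqrt (2 / 3)) := himg g₁ A₁ hg₁ hg₁'
  have hΛ₂ : A₂ '' fccStacking 1 (Real.sqrt (2 / 3)) = B₁ '' (R '' fccStacking 1 (Real.sqrt (2 / 3))) := by
    rw [himg g₂ A₂ hg₂ hg₂', ← Set.image_comp]
    exact Set.image_congr fun x _ => (hRapp x).symm
  have htr : ∀ S : Set (EuclideanSpace ℝ (Fin 3)), (L.trans B₁) '' S = B₁ '' (L '' S) := fun S => by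
    rw [LinearIsometryEquiv.coe_trans, Set.image_comp]
  have haff := coaxial_of_common_frame A₁ A₂ (L.trans B₁) 0 0 ?_ ?_
  · obtain ⟨L', s₁, s₂, σ, σ', hσ, hσ', h₁, h₂⟩ := haff
    refine ⟨L', s₁, s₂, σ, σ', hσ, hσ', ?_, ?_⟩
    · simpa using h₁
    · simpa using h₂
  · rw [htr, htr, hΛ₁]
    rcases hL1 with h | h
    · left; rw [← h]
    · right; rw [← h]
  · rw [htr, htr, hΛ₂]
    rcases hL2 with h | h
    · left; rw [← h]
    · right; rw [← h]

end Summit.Ventures.Crystal3D.Theorems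

end
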